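import Mathlib.Analysis.Fourier.AddCircleMulti
import Literature.Analysis.FunctionSpaces.Complexify
import Literature.Analysis.FunctionSpaces.FlatTorus
import Literature.Analysis.FunctionSpaces.TorusSobolevNorm
import HarnessLib

/-!
# Parseval on the flat torus for `L²` functions and complexified real vector fields

`Mathlib.Analysis.Fourier.AddCircleMulti` proves Parseval's identity
(`UnitAddTorus.hasSum_sq_mFourierCoeff`, `UnitAddTorus.hasSum_prod_mFourierCoeff`) for
*elements of* `L²(UnitAddTorus d)` (scalar, `ℂ`-valued) with respect to Mathlib's *local*
normalised volume `Measure.pi fun _ ↦ AddCircle.haarAddCircle`. The Literature works with honest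
functions and the *global* `volume` (`Torus.volume_eq_pi_haarAddCircle` transports between the
two), and its fluid statements see real vector fields `v : T^d → ℝ^d` through the
complexification `EuclideanSpace.complexify ∘ v` (`Torus.eGradNormSq`, `Torus.MemL2Sobolev`,
`Torus.eSobolevNorm`). This file provides the function-level bridges:

* `Torus.mFourierCoeff_congr_ae` — a.e.-equal functions have the same Fourier coefficients;
* `Torus.hasSum_sq_norm_mFourierCoeff` — Parseval `∑_k ‖ĝ(k)‖² = ∫ ‖g‖²` for a *function*
  `g ∈ L²(T^d; ℂ)` (global volume);
* `Torus.hasSum_sq_norm_mFourierCoeff_complexify` — Parseval for real vector fields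
  `v ∈ L²(T^d; ℝ^d)`: `∑_k ‖𝓕(complexify ∘ v)(k)‖² = ∫ ‖v‖²` (componentwise reduction through
  the accepted `Torus.mFourierCoeff_complexify_apply`);
* `Torus.hasSum_conj_mul_mFourierCoeff`, `Torus.hasSum_inner_mFourierCoeff_complexify`,
  `Torus.hasSum_re_inner_mFourierCoeff_complexify` — the polarised identities
  `∑_k ⟪𝓕v(k), 𝓕w(k)⟫ = ∫ ⟪v, w⟫` (scalar and real-vector forms);
* `Torus.tsum_enorm_sq_mFourierCoeff_complexify`, `Torus.eSobolevNorm_zero_complexify`,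
  `Torus.memSobolev_zero_complexify` — the consequences `H⁰ = L²` for complexified real fields:
  `‖complexify ∘ v‖_{H⁰} = ‖v‖_{L²}` and `v ∈ L² → complexify ∘ v ∈ H⁰` (the case of the named
  facts `Torus.eSobolevNorm_zero_eq_eLpNorm` / `Torus.memSobolev_zero_iff` that the fluid files
  consume).

These are steps of the passage to the limit in Hopf's Galerkin scheme
(`Literature/Analysis/FluidPDE/NSHopfGalerkin`: kinetic energy, dissipation and `H¹` norms are
read off the Fourier coefficients).

## Mathlib search

Used: `UnitAddTorus.hasSum_sq_mFourierCoeff` (Parseval for `Lp ℂ 2`), `MemLp.toLp`,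
`MemLp.coeFn_toLp`, `EuclideanSpace.norm_sq_eq`, `MemLp.eLpNorm_eq_integral_rpow_norm`.
Mathlib has no function-level or vector-valued Parseval on `UnitAddTorus` (searched
`hasSum_sq_mFourierCoeff`, `Parseval`: only the `Lp` scalar form).

## References

* L. Grafakos, *Classical Fourier Analysis*, 3rd ed., GTM 249 (2014), Prop. 3.2.7 (3)
  (Plancherel/Parseval on `T^n`), §3.1.
-/

open MeasureTheory Set Filter Topology UnitAddTorus
open scoped ENNReal NNReal

noncomputable section

namespace Literature.Analysis.FunctionSpaces

namespace Torus

variable {d : Type*} [Fintype d]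

section Scalar

variable {F : Type*} [NormedAddCommGroup F] [NormedSpace ℂ F]

/-- Fourier coefficients only see the a.e.-class (for the global volume, equivalently Mathlib's
local Haar volume): `f = g` a.e. implies `f̂ = ĝ`. [folklore] -/
theorem mFourierCoeff_congr_ae {f g : UnitAddTorus d → F} (h : f =ᵐ[volume] g) (k : d → ℤ) :
    mFourierCoeff f k = mFourierCoeff g k := by
  have h' : f =ᵐ[Measure.pi fun _ : d => AddCircle.haarAddCircle] g :=
    volume_eq_pi_haarAddCircle (d := d) ▸ h
  unfold mFourierCoeff
  refine integral_congr_ae ?_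
  filter_upwards [h'] with x hx
  rw [hx]

/-- **Parseval for `L²` functions on `T^d`** (Grafakos, Prop. 3.2.7 (3)): for `g ∈ L²(T^d; ℂ)`
(an honest function, global volume), `∑_{k ∈ ℤ^d} ‖ĝ(k)‖² = ∫ ‖g‖²`, as a `HasSum`. Transport of
Mathlib's `UnitAddTorus.hasSum_sq_mFourierCoeff` (stated for elements of `Lp ℂ 2` and the local
Haar volume) along `MemLp.toLp` and `Torus.volume_eq_pi_haarAddCircle`. [cite: Grafakos2014, Prop. 3.2.7 (3)] -/
theorem hasSum_sq_norm_mFourierCoeff {g : UnitAddTorus d → ℂ} (hg : MemLp g 2 volume) :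
    HasSum (fun k : d → ℤ => ‖mFourierCoeff g k‖ ^ 2) (∫ x, ‖g x‖ ^ 2) := by
  have hg' : MemLp g 2 (Measure.pi fun _ : d => AddCircle.haarAddCircle) :=
    volume_eq_pi_haarAddCircle (d := d) ▸ hg
  have h := UnitAddTorus.hasSum_sq_mFourierCoeff (hg'.toLp g)
  have hae : (hg'.toLp g : UnitAddTorus d → ℂ) =ᵐ[volume] g := by
    rw [volume_eq_pi_haarAddCircle]
    exact hg'.coeFn_toLp
  have h1 : ∀ k, mFourierCoeff (hg'.toLp g : UnitAddTorus d → ℂ) k = mFourierCoeff g k :=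
    fun k => mFourierCoeff_congr_ae hae k
  have h2 : ∫ x, ‖(hg'.toLp g : UnitAddTorus d → ℂ) x‖ ^ 2 ∂(Measure.pi fun _ : d =>
      AddCircle.haarAddCircle) = ∫ x, ‖g x‖ ^ 2 := by
    rw [volume_eq_pi_haarAddCircle]
    refine integral_congr_ae ?_
    filter_upwards [hg'.coeFn_toLp] with x hx
    rw [hx]
  simp only [h1] at h
  convert h using 1
  exact h2.symm

/-- **Parseval for inner products of `L²` functions on `T^d`** (Grafakos, Prop. 3.2.7 (3),
polarised): for `g, h ∈ L²(T^d; ℂ)` (honest functions, global volume),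
`∑_k conj(ĝ(k)) ĥ(k) = ∫ conj(g) h` as a `HasSum`. Transport of Mathlib's
`UnitAddTorus.hasSum_prod_mFourierCoeff`. [cite: Grafakos2014, Prop. 3.2.7 (3)] -/
theorem hasSum_conj_mul_mFourierCoeff {g h : UnitAddTorus d → ℂ} (hg : MemLp g 2 volume)
    (hh : MemLp h 2 volume) :
    HasSum (fun k : d → ℤ => starRingEnd ℂ (mFourierCoeff g k) * mFourierCoeff h k)
      (∫ x, starRingEnd ℂ (g x) * h x) := by
  have hg' : MemLp g 2 (Measure.pi fun _ : d => AddCircle.haarAddCircle) :=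
    volume_eq_pi_haarAddCircle (d := d) ▸ hg
  have hh' : MemLp h 2 (Measure.pi fun _ : d => AddCircle.haarAddCircle) :=
    volume_eq_pi_haarAddCircle (d := d) ▸ hh
  have H := UnitAddTorus.hasSum_prod_mFourierCoeff (hg'.toLp g) (hh'.toLp h)
  have haeg : (hg'.toLp g : UnitAddTorus d → ℂ) =ᵐ[volume] g := by
    rw [volume_eq_pi_haarAddCircle]
    exact hg'.coeFn_toLp
  have haeh : (hh'.toLp h : UnitAddTorus d → ℂ) =ᵐ[volume] h := by
    rw [volume_eq_pi_haarAddCircle]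
    exact hh'.coeFn_toLp
  have h1 : ∀ k, mFourierCoeff (hg'.toLp g : UnitAddTorus d → ℂ) k = mFourierCoeff g k :=
    fun k => mFourierCoeff_congr_ae haeg k
  have h1' : ∀ k, mFourierCoeff (hh'.toLp h : UnitAddTorus d → ℂ) k = mFourierCoeff h k :=
    fun k => mFourierCoeff_congr_ae haeh k
  have h2 : ∫ x, starRingEnd ℂ ((hg'.toLp g : UnitAddTorus d → ℂ) x) *
      (hh'.toLp h : UnitAddTorus d → ℂ) x ∂(Measure.pi fun _ : d => AddCircle.haarAddCircle) =
      ∫ x, starRingEnd ℂ (g x) * h x := by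
    rw [volume_eq_pi_haarAddCircle]
    refine integral_congr_ae ?_
    filter_upwards [hg'.coeFn_toLp, hh'.coeFn_toLp] with x hx hy
    rw [hx, hy]
  simp only [h1, h1'] at H
  convert H using 1
  exact h2.symm

end Scalar

/-! ### Real vector fields through the complexification -/

section Vector

/-- The components `x ↦ (v x i : ℂ)` of an `L²` real vector field are `L²` scalar functions
(`‖(v x i : ℂ)‖ = |v x i| ≤ ‖v x‖`). [folklore] -/
theorem memLp_ofReal_apply {v : UnitAddTorus d → EuclideanSpace ℝ d} (hv : MemLp v 2 volume)
    (i : d) : MemLp (fun x => (v x i : ℂ)) 2 volume := by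
  have h1 : MemLp (fun x => v x i) 2 volume := hv.eval_piLp i
  exact Complex.ofRealCLM.comp_memLp' h1  -- `(v x i : ℂ) = ofRealCLM (v x i)`

/-- **Parseval for real vector fields on `T^d`**: for `v ∈ L²(T^d; ℝ^d)`,
`∑_{k ∈ ℤ^d} ‖𝓕(complexify ∘ v)(k)‖² = ∫ ‖v‖²` as a `HasSum` — componentwise
(`Torus.mFourierCoeff_complexify_apply`, `EuclideanSpace.norm_sq_eq`) from the scalar Parseval
identity (Grafakos, Prop. 3.2.7 (3)). This is the identity behind reading the kinetic energy
`½∫‖v‖²` off the Fourier coefficients. [cite: Grafakos2014, Prop. 3.2.7 (3)] -/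
theorem hasSum_sq_norm_mFourierCoeff_complexify {v : UnitAddTorus d → EuclideanSpace ℝ d}
    (hv : MemLp v 2 volume) :
    HasSum (fun k : d → ℤ => ‖mFourierCoeff (EuclideanSpace.complexify ∘ v) k‖ ^ 2)
      (∫ x, ‖v x‖ ^ 2) := by
  have hint : Integrable v volume := hv.integrable one_le_two
  -- componentwise Parseval
  have hcomp : ∀ i : d, HasSum (fun k : d → ℤ => ‖mFourierCoeff (fun x => (v x i : ℂ)) k‖ ^ 2)
      (∫ x, ‖(v x i : ℂ)‖ ^ 2) := fun i => hasSum_sq_norm_mFourierCoeff (memLp_ofReal_apply hv i)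
  have hsum := hasSum_sum (s := Finset.univ) fun i _ => hcomp i
  -- identify the terms
  have hterm : ∀ k : d → ℤ, ∑ i, ‖mFourierCoeff (fun x => (v x i : ℂ)) k‖ ^ 2 =
      ‖mFourierCoeff (EuclideanSpace.complexify ∘ v) k‖ ^ 2 := fun k => by
    rw [EuclideanSpace.norm_sq_eq]
    refine Finset.sum_congr rfl fun i _ => ?_
    rw [mFourierCoeff_complexify_apply hint k i]
  -- identify the sum of the integrals
  have hcompInt : ∀ i : d, Integrable (fun x => ‖(v x i : ℂ)‖ ^ 2) volume := fun i =>
    (memLp_ofReal_apply hv i).integrable_norm_pow two_ne_zero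
  have hval : ∑ i, ∫ x, ‖(v x i : ℂ)‖ ^ 2 = ∫ x, ‖v x‖ ^ 2 := by
    rw [← integral_finsetSum _ fun i _ => hcompInt i]
    refine integral_congr_ae (ae_of_all _ fun x => ?_)
    dsimp only
    rw [EuclideanSpace.norm_sq_eq]
    refine Finset.sum_congr rfl fun i _ => ?_
    simp [Complex.norm_real]
  simp only [hterm] at hsum
  rwa [hval] at hsum

/-- `∫ ‖v‖² = ∑' ‖𝓕(complexify ∘ v)(k)‖²` for `v ∈ L²(T^d; ℝ^d)` (`tsum` form of
`hasSum_sq_norm_mFourierCoeff_complexify`). [folklore] -/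
theorem integral_norm_sq_eq_tsum {v : UnitAddTorus d → EuclideanSpace ℝ d}
    (hv : MemLp v 2 volume) :
    ∫ x, ‖v x‖ ^ 2 = ∑' k : d → ℤ, ‖mFourierCoeff (EuclideanSpace.complexify ∘ v) k‖ ^ 2 :=
  (hasSum_sq_norm_mFourierCoeff_complexify hv).tsum_eq.symm

/-- Extended form of Parseval for real vector fields: `∑' ‖𝓕(complexify ∘ v)(k)‖ₑ² = ∫⁻ ‖v‖ₑ²`
in `ℝ≥0∞`, for `v ∈ L²(T^d; ℝ^d)`. [folklore] -/
theorem tsum_enorm_sq_mFourierCoeff_complexify {v : UnitAddTorus d → EuclideanSpace ℝ d}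
    (hv : MemLp v 2 volume) :
    ∑' k : d → ℤ, ‖mFourierCoeff (EuclideanSpace.complexify ∘ v) k‖ₑ ^ 2 =
      ∫⁻ x, ‖v x‖ₑ ^ 2 := by
  have h := hasSum_sq_norm_mFourierCoeff_complexify hv
  have hlhs : ∑' k : d → ℤ, ‖mFourierCoeff (EuclideanSpace.complexify ∘ v) k‖ₑ ^ 2 =
      ENNReal.ofReal (∫ x, ‖v x‖ ^ 2) := by
    rw [← h.tsum_eq, ENNReal.ofReal_tsum_of_nonneg (fun k => sq_nonneg _) h.summable]
    refine tsum_congr fun k => ?_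
    rw [← ofReal_norm, ← ENNReal.ofReal_pow (norm_nonneg _)]
  have hrhs : ENNReal.ofReal (∫ x, ‖v x‖ ^ 2) = ∫⁻ x, ‖v x‖ₑ ^ 2 := by
    rw [ofReal_integral_eq_lintegral_ofReal (hv.integrable_norm_pow two_ne_zero)
      (ae_of_all _ fun x => by positivity)]
    refine lintegral_congr fun x => ?_
    rw [← ofReal_norm, ← ENNReal.ofReal_pow (norm_nonneg _)]
  rw [hlhs, hrhs]

/-- **Parseval for inner products of real vector fields on `T^d`**: for `v, w ∈ L²(T^d; ℝ^d)`,
`∑_k ⟪𝓕(complexify ∘ v)(k), 𝓕(complexify ∘ w)(k)⟫_ℂ = ∫ ⟪v, w⟫_ℝ` (as a `HasSum` in `ℂ`;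
componentwise from `hasSum_conj_mul_mFourierCoeff`, Mathlib's inner product on `ℂ^d` being
`∑ᵢ conj(aᵢ) bᵢ`; Grafakos, Prop. 3.2.7 (3)). This is the identity behind reading `L²` pairings
`∫ ⟪u(t), w⟫` — weak `L²` convergence and continuity — off the Fourier coefficients. [cite: Grafakos2014, Prop. 3.2.7 (3)] -/
theorem hasSum_inner_mFourierCoeff_complexify {v w : UnitAddTorus d → EuclideanSpace ℝ d}
    (hv : MemLp v 2 volume) (hw : MemLp w 2 volume) :
    HasSum (fun k : d → ℤ => inner ℂ (mFourierCoeff (EuclideanSpace.complexify ∘ v) k)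
        (mFourierCoeff (EuclideanSpace.complexify ∘ w) k))
      ((∫ x, inner ℝ (v x) (w x) : ℝ) : ℂ) := by
  have hvi : Integrable v volume := hv.integrable one_le_two
  have hwi : Integrable w volume := hw.integrable one_le_two
  have hcomp : ∀ i : d, HasSum (fun k : d → ℤ =>
      starRingEnd ℂ (mFourierCoeff (fun x => (v x i : ℂ)) k) * mFourierCoeff (fun x => (w x i : ℂ)) k)
      (∫ x, starRingEnd ℂ (v x i : ℂ) * (w x i : ℂ)) := fun i =>
    hasSum_conj_mul_mFourierCoeff (memLp_ofReal_apply hv i) (memLp_ofReal_apply hw i)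
  have hsum := hasSum_sum (s := Finset.univ) fun i _ => hcomp i
  have hterm : ∀ k : d → ℤ, ∑ i, starRingEnd ℂ (mFourierCoeff (fun x => (v x i : ℂ)) k) *
      mFourierCoeff (fun x => (w x i : ℂ)) k =
      inner ℂ (mFourierCoeff (EuclideanSpace.complexify ∘ v) k)
        (mFourierCoeff (EuclideanSpace.complexify ∘ w) k) := fun k => by
    rw [PiLp.inner_apply]
    refine Finset.sum_congr rfl fun i _ => ?_
    rw [mFourierCoeff_complexify_apply hvi k i, mFourierCoeff_complexify_apply hwi k i]
    simp [mul_comm]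
  have hcompInt : ∀ i : d, Integrable (fun x => starRingEnd ℂ (v x i : ℂ) * (w x i : ℂ)) volume :=
    fun i => by
    have : Integrable (fun x => ((v x i * w x i : ℝ) : ℂ)) volume :=
      ((hv.eval_piLp i).integrable_mul (hw.eval_piLp i)).ofReal
    refine this.congr (ae_of_all _ fun x => ?_)
    simp
  have hval : ∑ i, ∫ x, starRingEnd ℂ (v x i : ℂ) * (w x i : ℂ) =
      ((∫ x, inner ℝ (v x) (w x) : ℝ) : ℂ) := by
    rw [← integral_finsetSum _ fun i _ => hcompInt i, ← integral_complex_ofReal]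
    refine integral_congr_ae (ae_of_all _ fun x => ?_)
    dsimp only
    rw [PiLp.inner_apply, Complex.ofReal_sum]
    refine Finset.sum_congr rfl fun i _ => ?_
    simp [mul_comm]
  simp only [hterm] at hsum
  rwa [hval] at hsum

/-- Real form of `hasSum_inner_mFourierCoeff_complexify`: `∫ ⟪v, w⟫_ℝ = ∑' Re ⟪𝓕v(k), 𝓕w(k)⟫_ℂ`
for `v, w ∈ L²(T^d; ℝ^d)`. [folklore] -/
theorem hasSum_re_inner_mFourierCoeff_complexify {v w : UnitAddTorus d → EuclideanSpace ℝ d}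
    (hv : MemLp v 2 volume) (hw : MemLp w 2 volume) :
    HasSum (fun k : d → ℤ => (inner ℂ (mFourierCoeff (EuclideanSpace.complexify ∘ v) k)
        (mFourierCoeff (EuclideanSpace.complexify ∘ w) k)).re)
      (∫ x, inner ℝ (v x) (w x)) := by
  simpa using Complex.hasSum_re (hasSum_inner_mFourierCoeff_complexify hv hw)

/-- If a real vector field `v` is integrable then so is its complexification `complexify ∘ v`
(composition with the real-linear isometry `complexify`). [folklore] -/
theorem integrable_complexify_comp {v : UnitAddTorus d → EuclideanSpace ℝ d}
    (hv : Integrable v volume) : Integrable (EuclideanSpace.complexify ∘ v) volume :=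
  ContinuousLinearMap.integrable_comp
    (EuclideanSpace.complexify (ι := d)).toContinuousLinearMap hv

/-- **`H⁰ = L²` for complexified real vector fields, norms**: for `v ∈ L²(T^d; ℝ^d)`,
`‖complexify ∘ v‖_{H⁰} = ‖v‖_{L²}` in `[0, ∞]` (Parseval; Grafakos, Prop. 3.2.7 (3)). This is the
case of the named fact `Torus.eSobolevNorm_zero_eq_eLpNorm` consumed by the fluid files, where
real fields enter the spectral scale through `complexify`. [cite: Grafakos2014, Prop. 3.2.7 (3)] -/
theorem eSobolevNorm_zero_complexify {v : UnitAddTorus d → EuclideanSpace ℝ d}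
    (hv : MemLp v 2 volume) :
    eSobolevNorm 0 (EuclideanSpace.complexify ∘ v) = eLpNorm v 2 volume := by
  unfold eSobolevNorm
  simp only [sobolevWeight_zero, one_pow, ENNReal.ofReal_one, one_mul]
  rw [tsum_enorm_sq_mFourierCoeff_complexify hv,
    eLpNorm_eq_lintegral_rpow_enorm_toReal two_ne_zero ENNReal.ofNat_ne_top]
  norm_num

/-- **`H⁰ = L²` for complexified real vector fields, membership**: `v ∈ L²(T^d; ℝ^d)` implies
`complexify ∘ v ∈ H⁰` (integrable with finite `H⁰` norm; Grafakos, Prop. 3.2.7). The direction of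
the named fact `Torus.memSobolev_zero_iff` used when checking the clause `Torus.MemL2Sobolev` of
`Torus.IsLerayHopfOn`. [cite: Grafakos2014, Prop. 3.2.7 (3)] -/
theorem memSobolev_zero_complexify {v : UnitAddTorus d → EuclideanSpace ℝ d}
    (hv : MemLp v 2 volume) : MemSobolev 0 (EuclideanSpace.complexify ∘ v) :=
  ⟨integrable_complexify_comp (hv.integrable one_le_two), by
    rw [eSobolevNorm_zero_complexify hv]
    exact hv.eLpNorm_lt_top⟩

end Vector

end Torus

end Literature.Analysis.FunctionSpaces
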